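import Summits.FinalStateConjecture.FinalStateConjecture.Theorems.EIHFluxBalanceModulatedKerrHandoffOneHoleParams

/-!
# Route EIHFluxBalance — `ModulatedKerrHandoff`, stub `stub_oneHoleMatching`: the tame regime, the parameter difference

Helper file for the crux `stmt-FinalStateConjecture-10167`
(`Summit.FinalStateConjecture.FinalStateConjecture.Theses.EIHFluxBalance.ModulatedKerrHandoff`),
line `photon-rocket-modulation`, stub `stub_oneHoleMatching`; continuation of `…OneHoleParams` (tame sizes).

* `tame_ck₁_ret`, `tame_ck₁_inst` — positive-order `C³` sizes of the parameter maps at a tame base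
  point, uniform (the large factor `‖x‖` only meets the tame frame rate `C_θA/U²`);
* `tame_ck_delta` — the full `C³` size of `p₁ − p₀` at a tame base point:
  `λ(x) = max {mass defect, frame defect, 0, position defect}` with the scale `ε` kept on the position
  defect (where it meets the retardation `Δ` and the size `‖x‖`).
-/

noncomputable section

-- `Summit.<S>.<S>.…` (single-problem summit, D-0017) trips core's duplicate-namespace linter.
set_option linter.dupNamespace false

open Set Filter Function Literature.Geometry.Lorentzian
open scoped Topology ContDiff

namespace Summit.FinalStateConjecture.FinalStateConjecture.Theorems

namespace OneHole

section Tame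

variable {M a : ℝ} {Mf : ℝ → ℝ} {Λ : ℝ → lorentzGroup} {ξ : ℝ → E3} {Uc : E4 → ℝ} {v A σ γ τ₀ : ℝ}

/-- **Size of the retarded parameter map at a tame base point.** With `U = U x ≥ τ₀`, frame rate
`η = C_θA/U²` and bounds `η ‖x‖ ≤ X₁`, `η (|U| + ‖ξ U‖ + 1 + A) ≤ X₂`, the map `p₁` has positive-order
`C³` size `≤ max (6AD³) (max (6C_θAD³) (max 0 (6D³X₁ + 8((1+3γ) + 6C_θAD³) + 24 X₂ D³)))`.
[folklore] -/
theorem tame_ck₁_ret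
    (hsm : ContDiff ℝ ∞ ξ ∧ ContDiff ℝ ∞ (fun t ↦ ((Λ t : E4 ≃L[ℝ] E4) : E4 →L[ℝ] E4)) ∧ ContDiff ℝ ∞ Mf)
    (hal : ∀ u, (Λ u : E4 ≃L[ℝ] E4) (E4.basisVector 0) =
      ((Λ u : E4 ≃L[ℝ] E4) (E4.basisVector 0)) 0 • E4.ofTimeSpace 1 (deriv ξ u) ∧
      1 ≤ ((Λ u : E4 ≃L[ℝ] E4) (E4.basisVector 0)) 0 ∧ ((Λ u : E4 ≃L[ℝ] E4) (E4.basisVector 0)) 0 ≤ γ)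
    (hgl : ∀ u, (∀ k, 1 ≤ k → k ≤ 5 → ‖iteratedDeriv k ξ u‖ ≤ A) ∧
      ∀ k ≤ 4, ‖iteratedDeriv k (fun t ↦ ((Λ t : E4 ≃L[ℝ] E4) : E4 →L[ℝ] E4)) u‖ ≤ A ∧
        |iteratedDeriv k Mf u| ≤ A)
    {Cθ : ℝ} (hCθ0 : 0 ≤ Cθ)
    (hCθ : ∀ (k : ℕ) (u : ℝ),
      ‖iteratedDeriv k (fun t ↦ (((Λ t : E4 ≃L[ℝ] E4).symm : E4 ≃L[ℝ] E4) : E4 →L[ℝ] E4)) u‖ ≤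
        Cθ * ‖iteratedDeriv k (fun t ↦ ((Λ t : E4 ≃L[ℝ] E4) : E4 →L[ℝ] E4)) u‖)
    (hτ₀ : 0 < τ₀)
    (htame : ∀ u, τ₀ ≤ u → ∀ k, 1 ≤ k → k ≤ 4 →
      u ^ 2 * ‖iteratedDeriv k (fun t ↦ ((Λ t : E4 ≃L[ℝ] E4) : E4 →L[ℝ] E4)) u‖ ≤ A)
    {DU : ℝ} (hDU1 : 1 ≤ DU) {x : E4}
    (hUx : ContDiffAt ℝ 3 Uc x ∧ ∀ i, 1 ≤ i → i ≤ 3 → ‖iteratedFDeriv ℝ i Uc x‖ ≤ DU) (hU : τ₀ ≤ Uc x)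
    (hU1 : 1 ≤ Uc x) {ε X₁ X₂ : ℝ} (hε : 0 < ε) (hε1 : ε ≤ 1) (hX₁ : Cθ * A / Uc x ^ 2 * ‖x‖ ≤ X₁)
    (hX₂ : Cθ * A / Uc x ^ 2 * (|Uc x| + ‖ξ (Uc x)‖ + 1 + A) ≤ X₂) :
    ContDiffAt ℝ 3 (fun y ↦ ((Mf (Uc y), ((((Λ (Uc y) : E4 ≃L[ℝ] E4).symm : E4 ≃L[ℝ] E4) : E4 →L[ℝ] E4),
        (ε * a, ε • E4.spatial ((Λ (Uc y) : E4 ≃L[ℝ] E4).symm (y - E4.ofTimeSpace (Uc y) (ξ (Uc y))))))) :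
        ℝ × ((E4 →L[ℝ] E4) × (ℝ × E3)))) x ∧
      ∀ i, 1 ≤ i → i ≤ 3 → ‖iteratedFDeriv ℝ i (fun y ↦ ((Mf (Uc y),
        ((((Λ (Uc y) : E4 ≃L[ℝ] E4).symm : E4 ≃L[ℝ] E4) : E4 →L[ℝ] E4),
        (ε * a, ε • E4.spatial ((Λ (Uc y) : E4 ≃L[ℝ] E4).symm (y - E4.ofTimeSpace (Uc y) (ξ (Uc y))))))) :
        ℝ × ((E4 →L[ℝ] E4) × (ℝ × E3)))) x‖ ≤
        max (6 * A * DU ^ 3) (max (6 * (Cθ * A) * DU ^ 3)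
          (max 0 (6 * DU ^ 3 * X₁ + 8 * ((1 + 3 * γ) + 6 * (Cθ * A) * DU ^ 3) + 24 * X₂ * DU ^ 3))) := by
  have hA0 : 0 ≤ A := A_nonneg hgl
  have hCA : 0 ≤ Cθ * A := mul_nonneg hCθ0 hA0
  have hU0 : 0 < Uc x := hτ₀.trans_le hU
  -- mass
  have hm : ContDiffAt ℝ 3 Mf (Uc x) ∧ ∀ i, 1 ≤ i → i ≤ 3 → ‖iteratedFDeriv ℝ i Mf (Uc x)‖ ≤ A :=
    ck₁_of_iteratedDeriv (n := 3) (hsm.2.2.of_le (WithTop.coe_le_coe.mpr le_top)).contDiffAt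
      fun i _ hi ↦ by rw [Real.norm_eq_abs]; exact ((hgl (Uc x)).2 i (by omega)).2
  have hmU := ck₁_comp_of_ck₁ hm hUx
  rw [max_eq_left hA0, max_eq_right hDU1, show (Nat.factorial 3 : ℝ) = 6 by norm_num] at hmU
  -- inverse boost (global rate for the boost slot)
  have hθg := ck₁_theta_global hCθ hsm.2.1 hCθ0 (fun u k hk ↦ ((hgl u).2 k hk).1) (Uc x)
  have hθ3 : ContDiffAt ℝ 3 (fun t ↦ (((Λ t : E4 ≃L[ℝ] E4).symm : E4 ≃L[ℝ] E4) : E4 →L[ℝ] E4)) (Uc x) ∧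
      ∀ i, 1 ≤ i → i ≤ 3 → ‖iteratedFDeriv ℝ i
        (fun t ↦ (((Λ t : E4 ≃L[ℝ] E4).symm : E4 ≃L[ℝ] E4) : E4 →L[ℝ] E4)) (Uc x)‖ ≤ Cθ * A :=
    ck₁_mono hθg (by norm_num) le_rfl
  have hθU := ck₁_comp_of_ck₁ hθ3 hUx
  rw [max_eq_left hCA, max_eq_right hDU1, show (Nat.factorial 3 : ℝ) = 6 by norm_num] at hθU
  -- spin
  have ha := ck₁_const 3 (ε * a) x
  -- position (tame rate for the frame)
  have hθt := tame_theta_Icc hsm.2.1 hCθ0 hCθ hτ₀ hA0 htame hU le_rfl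
  have hθt3 : ContDiffAt ℝ 3 (fun t ↦ (((Λ t : E4 ≃L[ℝ] E4).symm : E4 ≃L[ℝ] E4) : E4 →L[ℝ] E4)) (Uc x) ∧
      ∀ i, 1 ≤ i → i ≤ 3 → ‖iteratedFDeriv ℝ i
        (fun t ↦ (((Λ t : E4 ≃L[ℝ] E4).symm : E4 ≃L[ℝ] E4) : E4 →L[ℝ] E4)) (Uc x)‖ ≤ Cθ * A / Uc x ^ 2 :=
    ck₁_mono hθt (by norm_num) le_rfl
  have hb := ck₁_restOffset hsm.2.1 hsm.1 (fun u ↦ (hgl u).1) (fun u ↦ ⟨(hal u).1, (hal u).2.1⟩) hθt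
  have hW := ck₁_scaledPosition (θp := fun t ↦ (((Λ t : E4 ≃L[ℝ] E4).symm : E4 ≃L[ℝ] E4) : E4 →L[ℝ] E4))
    (bp := fun u ↦ E4.spatial ((Λ u : E4 ≃L[ℝ] E4).symm (E4.ofTimeSpace u (ξ u)))) (τ := Uc) (x := x)
    hUx hDU1 (norm_theta_le (hal (Uc x)).2.1 (hal (Uc x)).2.2) hθt3 hb hε
  have hWeq : (fun y ↦ ε • (E4.spatial ((((Λ (Uc y) : E4 ≃L[ℝ] E4).symm : E4 ≃L[ℝ] E4) : E4 →L[ℝ] E4) y) -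
      E4.spatial ((Λ (Uc y) : E4 ≃L[ℝ] E4).symm (E4.ofTimeSpace (Uc y) (ξ (Uc y)))))) =
      fun y ↦ ε • E4.spatial ((Λ (Uc y) : E4 ≃L[ℝ] E4).symm (y - E4.ofTimeSpace (Uc y) (ξ (Uc y)))) := by
    funext y
    rw [map_sub, map_sub, ContinuousLinearEquiv.coe_coe]
  rw [hWeq] at hW
  have hW' := ck₁_mono hW le_rfl (show ε * (6 * (Cθ * A / Uc x ^ 2) * DU ^ 3 * ‖x‖ +
      8 * ((1 + 3 * γ) + 6 * (Cθ * A / Uc x ^ 2) * DU ^ 3) +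
      6 * (4 * (Cθ * A / Uc x ^ 2) * (|Uc x| + ‖ξ (Uc x)‖ + 1 + A)) * DU ^ 3) ≤
      6 * DU ^ 3 * X₁ + 8 * ((1 + 3 * γ) + 6 * (Cθ * A) * DU ^ 3) + 24 * X₂ * DU ^ 3 from ?_)
  · exact ck₁_prodMk hmU (ck₁_prodMk hθU (ck₁_prodMk ha hW'))
  · have hD3 : 0 ≤ DU ^ 3 := by positivity
    have hγ : 0 ≤ 1 + 3 * γ := by linarith [one_le_gamma hal]
    have hη : 0 ≤ Cθ * A / Uc x ^ 2 := by positivity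
    have hη1 : Cθ * A / Uc x ^ 2 ≤ Cθ * A := by
      have hU2 : 1 ≤ Uc x ^ 2 := by nlinarith [hU1]
      exact div_le_self hCA hU2
    have e1 : ε * (6 * (Cθ * A / Uc x ^ 2) * DU ^ 3 * ‖x‖) ≤ 6 * DU ^ 3 * X₁ := by
      calc ε * (6 * (Cθ * A / Uc x ^ 2) * DU ^ 3 * ‖x‖)
          = ε * (6 * DU ^ 3 * (Cθ * A / Uc x ^ 2 * ‖x‖)) := by ring
        _ ≤ 1 * (6 * DU ^ 3 * X₁) := by
          refine mul_le_mul hε1 ?_ (by positivity) zero_le_one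
          exact mul_le_mul_of_nonneg_left hX₁ (by positivity)
        _ = _ := one_mul _
    have e2 : ε * (8 * ((1 + 3 * γ) + 6 * (Cθ * A / Uc x ^ 2) * DU ^ 3)) ≤
        8 * ((1 + 3 * γ) + 6 * (Cθ * A) * DU ^ 3) := by
      have h1 : 8 * ((1 + 3 * γ) + 6 * (Cθ * A / Uc x ^ 2) * DU ^ 3) ≤
          8 * ((1 + 3 * γ) + 6 * (Cθ * A) * DU ^ 3) := by nlinarith
      exact (mul_le_of_le_one_left (by positivity) hε1).trans h1
    have e3 : ε * (6 * (4 * (Cθ * A / Uc x ^ 2) * (|Uc x| + ‖ξ (Uc x)‖ + 1 + A)) * DU ^ 3) ≤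
        24 * X₂ * DU ^ 3 := by
      calc ε * (6 * (4 * (Cθ * A / Uc x ^ 2) * (|Uc x| + ‖ξ (Uc x)‖ + 1 + A)) * DU ^ 3)
          = ε * (24 * (Cθ * A / Uc x ^ 2 * (|Uc x| + ‖ξ (Uc x)‖ + 1 + A)) * DU ^ 3) := by ring
        _ ≤ 1 * (24 * X₂ * DU ^ 3) := by
          refine mul_le_mul hε1 ?_ (by positivity) zero_le_one
          exact mul_le_mul_of_nonneg_right (mul_le_mul_of_nonneg_left hX₂ (by norm_num)) hD3
        _ = _ := one_mul _
    calc _ = ε * (6 * (Cθ * A / Uc x ^ 2) * DU ^ 3 * ‖x‖) +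
          ε * (8 * ((1 + 3 * γ) + 6 * (Cθ * A / Uc x ^ 2) * DU ^ 3)) +
          ε * (6 * (4 * (Cθ * A / Uc x ^ 2) * (|Uc x| + ‖ξ (Uc x)‖ + 1 + A)) * DU ^ 3) := by ring
      _ ≤ _ := add_le_add (add_le_add e1 e2) e3

/-- **Size of the instantaneous parameter map at a tame base point** (clock `y ↦ y⁰`, frame rate
`C_θA/U²` valid at `x⁰ ≥ U`). [folklore] -/
theorem tame_ck₁_inst
    (hsm : ContDiff ℝ ∞ ξ ∧ ContDiff ℝ ∞ (fun t ↦ ((Λ t : E4 ≃L[ℝ] E4) : E4 →L[ℝ] E4)) ∧ ContDiff ℝ ∞ Mf)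
    (hal : ∀ u, (Λ u : E4 ≃L[ℝ] E4) (E4.basisVector 0) =
      ((Λ u : E4 ≃L[ℝ] E4) (E4.basisVector 0)) 0 • E4.ofTimeSpace 1 (deriv ξ u) ∧
      1 ≤ ((Λ u : E4 ≃L[ℝ] E4) (E4.basisVector 0)) 0 ∧ ((Λ u : E4 ≃L[ℝ] E4) (E4.basisVector 0)) 0 ≤ γ)
    (hgl : ∀ u, (∀ k, 1 ≤ k → k ≤ 5 → ‖iteratedDeriv k ξ u‖ ≤ A) ∧
      ∀ k ≤ 4, ‖iteratedDeriv k (fun t ↦ ((Λ t : E4 ≃L[ℝ] E4) : E4 →L[ℝ] E4)) u‖ ≤ A ∧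
        |iteratedDeriv k Mf u| ≤ A)
    {Cθ : ℝ} (hCθ0 : 0 ≤ Cθ)
    (hCθ : ∀ (k : ℕ) (u : ℝ),
      ‖iteratedDeriv k (fun t ↦ (((Λ t : E4 ≃L[ℝ] E4).symm : E4 ≃L[ℝ] E4) : E4 →L[ℝ] E4)) u‖ ≤
        Cθ * ‖iteratedDeriv k (fun t ↦ ((Λ t : E4 ≃L[ℝ] E4) : E4 →L[ℝ] E4)) u‖)
    (hτ₀ : 0 < τ₀)
    (htame : ∀ u, τ₀ ≤ u → ∀ k, 1 ≤ k → k ≤ 4 →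
      u ^ 2 * ‖iteratedDeriv k (fun t ↦ ((Λ t : E4 ≃L[ℝ] E4) : E4 →L[ℝ] E4)) u‖ ≤ A)
    {x : E4} {U : ℝ} (hU : τ₀ ≤ U) (hU1 : 1 ≤ U) (hUt : U ≤ x 0)
    {ε X₁ X₂ : ℝ} (hε : 0 < ε) (hε1 : ε ≤ 1) (hX₁ : Cθ * A / U ^ 2 * ‖x‖ ≤ X₁)
    (hX₂ : Cθ * A / U ^ 2 * (|x 0| + ‖ξ (x 0)‖ + 1 + A) ≤ X₂) :
    ContDiffAt ℝ 3 (fun y ↦ ((M, ((((Λ (y 0) : E4 ≃L[ℝ] E4).symm : E4 ≃L[ℝ] E4) : E4 →L[ℝ] E4),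
        (ε * a, ε • E4.spatial ((Λ (y 0) : E4 ≃L[ℝ] E4).symm (y - E4.ofTimeSpace (y 0) (ξ (y 0))))))) :
        ℝ × ((E4 →L[ℝ] E4) × (ℝ × E3)))) x ∧
      ∀ i, 1 ≤ i → i ≤ 3 → ‖iteratedFDeriv ℝ i (fun y ↦ ((M,
        ((((Λ (y 0) : E4 ≃L[ℝ] E4).symm : E4 ≃L[ℝ] E4) : E4 →L[ℝ] E4),
        (ε * a, ε • E4.spatial ((Λ (y 0) : E4 ≃L[ℝ] E4).symm (y - E4.ofTimeSpace (y 0) (ξ (y 0))))))) :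
        ℝ × ((E4 →L[ℝ] E4) × (ℝ × E3)))) x‖ ≤
        max 0 (max (6 * (Cθ * A)) (max 0 (6 * X₁ + 8 * ((1 + 3 * γ) + 6 * (Cθ * A)) + 24 * X₂))) := by
  have hA0 : 0 ≤ A := A_nonneg hgl
  have hCA : 0 ≤ Cθ * A := mul_nonneg hCθ0 hA0
  have hU0 : 0 < U := hτ₀.trans_le hU
  have hπ : ContDiffAt ℝ 3 (fun y : E4 ↦ y 0) x ∧
      ∀ i, 1 ≤ i → i ≤ 3 → ‖iteratedFDeriv ℝ i (fun y : E4 ↦ y 0) x‖ ≤ 1 :=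
    ck₁_mono (ck₁_clm 3 (EuclideanSpace.proj (0 : Fin 4) : E4 →L[ℝ] ℝ) x) le_rfl norm_dt_le
  have hm := ck₁_const 3 M x
  have hθg := ck₁_theta_global hCθ hsm.2.1 hCθ0 (fun u k hk ↦ ((hgl u).2 k hk).1) (x 0)
  have hθ3 : ContDiffAt ℝ 3 (fun t ↦ (((Λ t : E4 ≃L[ℝ] E4).symm : E4 ≃L[ℝ] E4) : E4 →L[ℝ] E4)) (x 0) ∧
      ∀ i, 1 ≤ i → i ≤ 3 → ‖iteratedFDeriv ℝ i
        (fun t ↦ (((Λ t : E4 ≃L[ℝ] E4).symm : E4 ≃L[ℝ] E4) : E4 →L[ℝ] E4)) (x 0)‖ ≤ Cθ * A :=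
    ck₁_mono hθg (by norm_num) le_rfl
  have hθt0 := ck₁_comp_of_ck₁ (g := fun t ↦ (((Λ t : E4 ≃L[ℝ] E4).symm : E4 ≃L[ℝ] E4) : E4 →L[ℝ] E4))
    (f := fun y : E4 ↦ y 0) (x := x) hθ3 hπ
  rw [max_eq_left hCA, max_self, one_pow, mul_one, show (Nat.factorial 3 : ℝ) = 6 by norm_num] at hθt0
  have ha := ck₁_const 3 (ε * a) x
  have hθt := tame_theta_Icc hsm.2.1 hCθ0 hCθ hτ₀ hA0 htame hU hUt
  have hθt3 : ContDiffAt ℝ 3 (fun t ↦ (((Λ t : E4 ≃L[ℝ] E4).symm : E4 ≃L[ℝ] E4) : E4 →L[ℝ] E4)) (x 0) ∧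
      ∀ i, 1 ≤ i → i ≤ 3 → ‖iteratedFDeriv ℝ i
        (fun t ↦ (((Λ t : E4 ≃L[ℝ] E4).symm : E4 ≃L[ℝ] E4) : E4 →L[ℝ] E4)) (x 0)‖ ≤ Cθ * A / U ^ 2 :=
    ck₁_mono hθt (by norm_num) le_rfl
  have hb := ck₁_restOffset hsm.2.1 hsm.1 (fun u ↦ (hgl u).1) (fun u ↦ ⟨(hal u).1, (hal u).2.1⟩) hθt
  have hW := ck₁_scaledPosition (θp := fun t ↦ (((Λ t : E4 ≃L[ℝ] E4).symm : E4 ≃L[ℝ] E4) : E4 →L[ℝ] E4))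
    (bp := fun u ↦ E4.spatial ((Λ u : E4 ≃L[ℝ] E4).symm (E4.ofTimeSpace u (ξ u)))) (τ := fun y : E4 ↦ y 0)
    (x := x) hπ le_rfl (norm_theta_le (hal (x 0)).2.1 (hal (x 0)).2.2) hθt3 hb hε
  have hWeq : (fun y : E4 ↦ ε • (E4.spatial ((((Λ (y 0) : E4 ≃L[ℝ] E4).symm : E4 ≃L[ℝ] E4) : E4 →L[ℝ] E4) y) -
      E4.spatial ((Λ (y 0) : E4 ≃L[ℝ] E4).symm (E4.ofTimeSpace (y 0) (ξ (y 0)))))) =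
      fun y ↦ ε • E4.spatial ((Λ (y 0) : E4 ≃L[ℝ] E4).symm (y - E4.ofTimeSpace (y 0) (ξ (y 0)))) := by
    funext y
    rw [map_sub, map_sub, ContinuousLinearEquiv.coe_coe]
  rw [hWeq, one_pow] at hW
  have hW' := ck₁_mono hW le_rfl (show ε * (6 * (Cθ * A / U ^ 2) * 1 * ‖x‖ +
      8 * ((1 + 3 * γ) + 6 * (Cθ * A / U ^ 2) * 1) +
      6 * (4 * (Cθ * A / U ^ 2) * (|x 0| + ‖ξ (x 0)‖ + 1 + A)) * 1) ≤
      6 * X₁ + 8 * ((1 + 3 * γ) + 6 * (Cθ * A)) + 24 * X₂ from ?_)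
  · exact ck₁_prodMk hm (ck₁_prodMk hθt0 (ck₁_prodMk ha hW'))
  · have hγ : 0 ≤ 1 + 3 * γ := by linarith [one_le_gamma hal]
    have hη : 0 ≤ Cθ * A / U ^ 2 := by positivity
    have hη1 : Cθ * A / U ^ 2 ≤ Cθ * A := by
      have hU2 : 1 ≤ U ^ 2 := by nlinarith [hU1]
      exact div_le_self hCA hU2
    have e1 : ε * (6 * (Cθ * A / U ^ 2) * 1 * ‖x‖) ≤ 6 * X₁ := by
      calc ε * (6 * (Cθ * A / U ^ 2) * 1 * ‖x‖) = ε * (6 * (Cθ * A / U ^ 2 * ‖x‖)) := by ring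
        _ ≤ 1 * (6 * X₁) :=
          mul_le_mul hε1 (mul_le_mul_of_nonneg_left hX₁ (by norm_num)) (by positivity) zero_le_one
        _ = _ := one_mul _
    have e2 : ε * (8 * ((1 + 3 * γ) + 6 * (Cθ * A / U ^ 2) * 1)) ≤ 8 * ((1 + 3 * γ) + 6 * (Cθ * A)) := by
      have h1 : 8 * ((1 + 3 * γ) + 6 * (Cθ * A / U ^ 2) * 1) ≤ 8 * ((1 + 3 * γ) + 6 * (Cθ * A)) := by
        nlinarith
      exact (mul_le_of_le_one_left (by positivity) hε1).trans h1
    have e3 : ε * (6 * (4 * (Cθ * A / U ^ 2) * (|x 0| + ‖ξ (x 0)‖ + 1 + A)) * 1) ≤ 24 * X₂ := by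
      calc ε * (6 * (4 * (Cθ * A / U ^ 2) * (|x 0| + ‖ξ (x 0)‖ + 1 + A)) * 1)
          = ε * (24 * (Cθ * A / U ^ 2 * (|x 0| + ‖ξ (x 0)‖ + 1 + A))) := by ring
        _ ≤ 1 * (24 * X₂) :=
          mul_le_mul hε1 (mul_le_mul_of_nonneg_left hX₂ (by norm_num)) (by positivity) zero_le_one
        _ = _ := one_mul _
    calc _ = ε * (6 * (Cθ * A / U ^ 2) * 1 * ‖x‖) + ε * (8 * ((1 + 3 * γ) + 6 * (Cθ * A / U ^ 2) * 1)) +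
          ε * (6 * (4 * (Cθ * A / U ^ 2) * (|x 0| + ‖ξ (x 0)‖ + 1 + A)) * 1) := by ring
      _ ≤ _ := add_le_add (add_le_add e1 e2) e3

/-- **The full `C³` size of the parameter difference at a tame base point.** With `U = U x`,
`Δ = x⁰ − U`, frame rate `η = C_θA/U²`:
`λ(x) = max (6 (A/U^{3/4+σ}) D³) (max (η(Δ + 12D³)) (max 0 (ε (η(Δ + 12D³)(‖x‖ + 8) + 4η(2x⁰ + 1 + A)(Δ + 12D³)))))`.
[folklore] -/
theorem tame_ck_delta
    (hsm : ContDiff ℝ ∞ ξ ∧ ContDiff ℝ ∞ (fun t ↦ ((Λ t : E4 ≃L[ℝ] E4) : E4 →L[ℝ] E4)) ∧ ContDiff ℝ ∞ Mf)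
    (hal : ∀ u, (Λ u : E4 ≃L[ℝ] E4) (E4.basisVector 0) =
      ((Λ u : E4 ≃L[ℝ] E4) (E4.basisVector 0)) 0 • E4.ofTimeSpace 1 (deriv ξ u) ∧
      1 ≤ ((Λ u : E4 ≃L[ℝ] E4) (E4.basisVector 0)) 0 ∧ ((Λ u : E4 ≃L[ℝ] E4) (E4.basisVector 0)) 0 ≤ γ)
    (hgl : ∀ u, (∀ k, 1 ≤ k → k ≤ 5 → ‖iteratedDeriv k ξ u‖ ≤ A) ∧
      ∀ k ≤ 4, ‖iteratedDeriv k (fun t ↦ ((Λ t : E4 ≃L[ℝ] E4) : E4 →L[ℝ] E4)) u‖ ≤ A ∧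
        |iteratedDeriv k Mf u| ≤ A)
    {Cθ : ℝ} (hCθ0 : 0 ≤ Cθ)
    (hCθ : ∀ (k : ℕ) (u : ℝ),
      ‖iteratedDeriv k (fun t ↦ (((Λ t : E4 ≃L[ℝ] E4).symm : E4 ≃L[ℝ] E4) : E4 →L[ℝ] E4)) u‖ ≤
        Cθ * ‖iteratedDeriv k (fun t ↦ ((Λ t : E4 ≃L[ℝ] E4) : E4 →L[ℝ] E4)) u‖)
    (hτ₀ : 0 < τ₀)
    (htame : ∀ u, τ₀ ≤ u → ∀ k, 1 ≤ k → k ≤ 4 →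
      u ^ 2 * ‖iteratedDeriv k (fun t ↦ ((Λ t : E4 ≃L[ℝ] E4) : E4 →L[ℝ] E4)) u‖ ≤ A)
    (htameM : ∀ u, τ₀ ≤ u → ∀ k ≤ 4, u ^ ((3 : ℝ) / 4 + σ) * |iteratedDeriv k (fun s ↦ Mf s - M) u| ≤ A)
    {DU : ℝ} (hDU1 : 1 ≤ DU) {x : E4}
    (hUx : ContDiffAt ℝ 3 Uc x ∧ ∀ i, 1 ≤ i → i ≤ 3 → ‖iteratedFDeriv ℝ i Uc x‖ ≤ DU) (hU : τ₀ ≤ Uc x)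
    (hUt : Uc x ≤ x 0) (hξI : ∀ s ∈ Icc (Uc x) (x 0), ‖ξ s‖ ≤ s) {ε : ℝ} (hε : 0 < ε) :
    ContDiffAt ℝ 3 (fun y ↦ ((Mf (Uc y), ((((Λ (Uc y) : E4 ≃L[ℝ] E4).symm : E4 ≃L[ℝ] E4) : E4 →L[ℝ] E4),
        (ε * a, ε • E4.spatial ((Λ (Uc y) : E4 ≃L[ℝ] E4).symm (y - E4.ofTimeSpace (Uc y) (ξ (Uc y))))))) :
        ℝ × ((E4 →L[ℝ] E4) × (ℝ × E3))) -
      ((M, ((((Λ (y 0) : E4 ≃L[ℝ] E4).symm : E4 ≃L[ℝ] E4) : E4 →L[ℝ] E4),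
        (ε * a, ε • E4.spatial ((Λ (y 0) : E4 ≃L[ℝ] E4).symm (y - E4.ofTimeSpace (y 0) (ξ (y 0))))))) :
        ℝ × ((E4 →L[ℝ] E4) × (ℝ × E3)))) x ∧
      ∀ i ≤ 3, ‖iteratedFDeriv ℝ i (fun y ↦ ((Mf (Uc y), ((((Λ (Uc y) : E4 ≃L[ℝ] E4).symm : E4 ≃L[ℝ] E4) :
          E4 →L[ℝ] E4),
        (ε * a, ε • E4.spatial ((Λ (Uc y) : E4 ≃L[ℝ] E4).symm (y - E4.ofTimeSpace (Uc y) (ξ (Uc y))))))) :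
        ℝ × ((E4 →L[ℝ] E4) × (ℝ × E3))) -
      ((M, ((((Λ (y 0) : E4 ≃L[ℝ] E4).symm : E4 ≃L[ℝ] E4) : E4 →L[ℝ] E4),
        (ε * a, ε • E4.spatial ((Λ (y 0) : E4 ≃L[ℝ] E4).symm (y - E4.ofTimeSpace (y 0) (ξ (y 0))))))) :
        ℝ × ((E4 →L[ℝ] E4) × (ℝ × E3)))) x‖ ≤
        max (6 * (A / Uc x ^ ((3 : ℝ) / 4 + σ)) * DU ^ 3)
          (max (Cθ * A / Uc x ^ 2 * ((x 0 - Uc x) + 12 * DU ^ 3))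
            (max ‖(0 : ℝ)‖ (ε * (Cθ * A / Uc x ^ 2 * ((x 0 - Uc x) + 12 * DU ^ 3) * ‖x‖ +
              8 * (Cθ * A / Uc x ^ 2 * ((x 0 - Uc x) + 12 * DU ^ 3)) +
              4 * (Cθ * A / Uc x ^ 2) * (2 * x 0 + 1 + A) * ((x 0 - Uc x) + 12 * DU ^ 3))))) := by
  have hA0 : 0 ≤ A := A_nonneg hgl
  have hδM := tame_ck_massDefect (M := M) hsm.2.2 hτ₀ htameM hDU1 hUx hU
  have hδθ := tame_ck_thetaDefect hsm.2.1 hCθ0 hCθ hτ₀ hA0 htame hDU1 hUx hU hUt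
  have hδb := tame_ck_offsetDefect hsm hal hgl hCθ0 hCθ hτ₀ htame hDU1 hUx hU hUt hξI
  have hδw := ck_scaledPosition_sub
    (Θd := fun y ↦ (((Λ (Uc y) : E4 ≃L[ℝ] E4).symm : E4 ≃L[ℝ] E4) : E4 →L[ℝ] E4) -
      (((Λ (y 0) : E4 ≃L[ℝ] E4).symm : E4 ≃L[ℝ] E4) : E4 →L[ℝ] E4))
    (Bd := fun y ↦ E4.spatial ((Λ (Uc y) : E4 ≃L[ℝ] E4).symm (E4.ofTimeSpace (Uc y) (ξ (Uc y)))) -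
      E4.spatial ((Λ (y 0) : E4 ≃L[ℝ] E4).symm (E4.ofTimeSpace (y 0) (ξ (y 0))))) (x := x) hδθ hδb hε
  have hzero := ck_const 3 (0 : ℝ) x
  have hprod := ck_prodMk hδM (ck_prodMk hδθ (ck_prodMk hzero hδw))
  refine ck_congr hprod (Eventually.of_forall fun y ↦ ?_)
  simp only [Prod.mk_sub_mk, sub_self]
  congr 2
  rw [← smul_sub]
  congr 1
  simp only [map_sub, FunLike.coe_sub, Pi.sub_apply, ContinuousLinearEquiv.coe_coe]
  abel

/-- **The position defect is linear in the frame defect and the offset defect**: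
`ε S(L₁(x − c₁)) − ε S(L₀(x − c₀)) = ε (S((L₁ − L₀)x) − (S L₁ c₁ − S L₀ c₀))`. [folklore] -/
theorem scaledPosition_sub_eq (ε : ℝ) (L₁ L₀ : E4 →L[ℝ] E4) (x c₁ c₀ : E4) :
    ε • E4.spatial (L₁ (x - c₁)) - ε • E4.spatial (L₀ (x - c₀)) =
      ε • (E4.spatial ((L₁ - L₀) x) - (E4.spatial (L₁ c₁) - E4.spatial (L₀ c₀))) := by
  rw [← smul_sub]
  congr 1
  simp only [map_sub, FunLike.coe_sub, Pi.sub_apply]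
  abel

end Tame

end OneHole

/-- Registered sub-goal form (stub `oneHole_scaledPosition_sub_eq` of the crux item) of
`OneHole.scaledPosition_sub_eq`: the position defect is linear in the frame and offset defects. [folklore] -/
theorem oneHole_scaledPosition_sub_eq : open Literature.Geometry.Lorentzian in ∀ (ε : ℝ) (L₁ L₀ : E4 →L[ℝ] E4) (x c₁ c₀ : E4), ε • E4.spatial (L₁ (x - c₁)) - ε • E4.spatial (L₀ (x - c₀)) = ε • (E4.spatial ((L₁ - L₀) x) - (E4.spatial (L₁ c₁) - E4.spatial (L₀ c₀))) :=
  fun ε L₁ L₀ x c₁ c₀ ↦ OneHole.scaledPosition_sub_eq ε L₁ L₀ x c₁ c₀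

end Summit.FinalStateConjecture.FinalStateConjecture.Theorems

end
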